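import Summits.Ventures.HodgeRepro2.T5Sl2Standard

/-!
# A model of the irreducible lowest-weight `sl₂(K)`-module of weight `μ`

Tier-5 support (N4.3 = (R3), step (P2′); route/T5-SUPPORT-p1.md §S4).  `T5Sl2LowestWeight` and
`T5Sl2Standard` describe every irreducible `sl₂(K)`-module with a lowest-weight vector of weight
`μ ∉ −ℕ`; this file (with its continuation) shows that such modules EXIST — so the hypotheses
of those theorems are satisfiable (non-vacuity) — by the explicit model on `ℕ →₀ K` with basis
`vₙ = single n 1`:

* the operators `E₀ vₙ = vₙ₊₁`, `F₀ vₙ₊₁ = (n + 1)(−μ − n) vₙ`, `F₀ v₀ = 0`,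
  `H₀ vₙ = (μ + 2n) vₙ` satisfy the `sl₂` relations (`E₀_F₀_comm`, `H₀_E₀_comm`, `H₀_F₀_comm`);
* `commutator_combination`: the commutator of two combinations of such operators in any
  algebra; hence `rho x = x₀₁ E₀ + x₁₀ F₀ + x₀₀ H₀` satisfies `rho ⁅x, y⁆ = [rho x, rho y]`
  (`rho_lie`), and `Model K μ` (a type synonym of `ℕ →₀ K`) is an `sl₂(K)`-module;
* `hasLowestWeightVector`: `v₀` is a lowest-weight vector of weight `μ`.

Irreducibility of the model for `μ ∉ −ℕ` and the instantiation of the weight theorems are in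
`T5Sl2LowestWeightModelIrreducible`.

What this file does NOT say: anything about `π₃⁺` itself — that its `K`-finite vectors are this
module (for `μ = 3`) is the printed input [C] of (P2′).

Blind lane: Mathlib + own prefix; no sorry; axioms ⊆ {propext, Classical.choice, Quot.sound}.
-/

namespace Summit.Ventures.HodgeRepro2.T5Sl2LowestWeightModel

noncomputable section

open LieAlgebra.SpecialLinear LieModule Module
open Summit.Ventures.HodgeRepro2.T5Sl2Standard Summit.Ventures.HodgeRepro2.T5Sl2LowestWeight

section Operators

variable (K : Type*) [Field K] (μ : K)

/-- The raising operator `E₀ : single n c ↦ single (n + 1) c`. -/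
def E₀ : (ℕ →₀ K) →ₗ[K] (ℕ →₀ K) :=
  Finsupp.lsum K fun n => LinearMap.toSpanSingleton K (ℕ →₀ K) (Finsupp.single (n + 1) 1)

/-- The lowering coefficient `n (1 − μ − n)`: `0` at `n = 0`, `(k + 1)(−μ − k)` at `n = k + 1`. -/
def lowerCoeff (n : ℕ) : K := (n : K) * (1 - μ - n)

/-- The lowering operator `F₀ : single n c ↦ single (n − 1) (n (1 − μ − n) c)`; it kills
`single 0`. -/
def F₀ : (ℕ →₀ K) →ₗ[K] (ℕ →₀ K) :=
  Finsupp.lsum K fun n =>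
    LinearMap.toSpanSingleton K (ℕ →₀ K) (Finsupp.single (n - 1) (lowerCoeff K μ n))

/-- The weight operator `H₀ : single n c ↦ single n ((μ + 2n) c)`. -/
def H₀ : (ℕ →₀ K) →ₗ[K] (ℕ →₀ K) :=
  Finsupp.lsum K fun n => LinearMap.toSpanSingleton K (ℕ →₀ K) (Finsupp.single n (μ + 2 * n))

/-- `E₀ (single n c) = single (n + 1) c`. -/
lemma E₀_single (n : ℕ) (c : K) : E₀ K (Finsupp.single n c) = Finsupp.single (n + 1) c := by
  simp [E₀, Finsupp.lsum_single]

/-- `F₀ (single 0 c) = 0`. -/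
lemma F₀_single_zero (c : K) : F₀ K μ (Finsupp.single 0 c) = 0 := by
  simp [F₀, Finsupp.lsum_single, lowerCoeff]

/-- `F₀ (single (n + 1) c) = single n ((n + 1)(−μ − n) c)`. -/
lemma F₀_single_succ (n : ℕ) (c : K) :
    F₀ K μ (Finsupp.single (n + 1) c) = Finsupp.single n (((n : K) + 1) * (-μ - n) * c) := by
  simp only [F₀, Finsupp.lsum_single, LinearMap.toSpanSingleton_apply, Finsupp.smul_single,
    smul_eq_mul, Nat.add_sub_cancel, lowerCoeff]
  congr 1
  push_cast
  ring

/-- `H₀ (single n c) = single n ((μ + 2n) c)`. -/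
lemma H₀_single (n : ℕ) (c : K) :
    H₀ K μ (Finsupp.single n c) = Finsupp.single n ((μ + 2 * n) * c) := by
  simp only [H₀, Finsupp.lsum_single, LinearMap.toSpanSingleton_apply, Finsupp.smul_single,
    smul_eq_mul]
  congr 1
  ring

/-- `E₀ F₀ − F₀ E₀ = H₀`. -/
lemma E₀_F₀_comm : E₀ K * F₀ K μ - F₀ K μ * E₀ K = H₀ K μ := by
  apply Finsupp.lhom_ext
  intro n c
  rcases n with _ | n
  · simp only [LinearMap.sub_apply, Module.End.mul_apply, F₀_single_zero, map_zero, E₀_single,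
      F₀_single_succ, H₀_single, zero_sub, ← Finsupp.single_neg]
    congr 1
    push_cast
    ring
  · simp only [LinearMap.sub_apply, Module.End.mul_apply, F₀_single_succ, E₀_single, H₀_single,
      ← Finsupp.single_sub]
    congr 1
    push_cast
    ring

/-- `H₀ E₀ − E₀ H₀ = 2 E₀`. -/
lemma H₀_E₀_comm : H₀ K μ * E₀ K - E₀ K * H₀ K μ = (2 : K) • E₀ K := by
  apply Finsupp.lhom_ext
  intro n c
  simp only [LinearMap.sub_apply, Module.End.mul_apply, E₀_single, H₀_single, LinearMap.smul_apply,
    Finsupp.smul_single, smul_eq_mul, ← Finsupp.single_sub]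
  congr 1
  push_cast
  ring

/-- `H₀ F₀ − F₀ H₀ = −2 F₀`. -/
lemma H₀_F₀_comm : H₀ K μ * F₀ K μ - F₀ K μ * H₀ K μ = -((2 : K) • F₀ K μ) := by
  apply Finsupp.lhom_ext
  intro n c
  rcases n with _ | n
  · simp only [LinearMap.sub_apply, Module.End.mul_apply, F₀_single_zero, map_zero, H₀_single,
      sub_zero, LinearMap.neg_apply, LinearMap.smul_apply, smul_zero, neg_zero]
  · simp only [LinearMap.sub_apply, Module.End.mul_apply, F₀_single_succ, H₀_single,
      LinearMap.neg_apply, LinearMap.smul_apply, Finsupp.smul_single, smul_eq_mul,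
      ← Finsupp.single_sub, ← Finsupp.single_neg]
    congr 1
    push_cast
    ring

/-- The commutator of two combinations of operators `E, F, H` satisfying the `sl₂` relations
`EF − FE = H`, `HE − EH = 2E`, `HF − FH = −2F`, in any `K`-algebra. -/
lemma commutator_combination {A : Type*} [Ring A] [Algebra K A] {E F H : A}
    (hEF : E * F - F * E = H) (hHE : H * E - E * H = (2 : K) • E)
    (hHF : H * F - F * H = -((2 : K) • F)) (a b c a' b' c' : K) :
    (a • E + b • F + c • H) * (a' • E + b' • F + c' • H) -
        (a' • E + b' • F + c' • H) * (a • E + b • F + c • H) =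
      (2 * (c * a' - a * c')) • E + (2 * (b * c' - c * b')) • F + (a * b' - b * a') • H := by
  have hEF' : E * F = H + F * E := by rw [← hEF]; abel
  have hHE' : H * E = (2 : K) • E + E * H := by rw [← hHE]; abel
  have hHF' : H * F = -((2 : K) • F) + F * H := by rw [← hHF]; abel
  simp only [add_mul, mul_add, smul_mul_assoc, mul_smul_comm, hEF', hHE', hHF']
  module

/-- The `(0, 1)` entry of a bracket in `sl₂(K)`. -/
lemma lie_val_zero_one (x y : sl (Fin 2) K) :
    ⁅x, y⁆.val 0 1 = 2 * (x.val 0 0 * y.val 0 1 - x.val 0 1 * y.val 0 0) := by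
  simp only [sl_bracket, Matrix.sub_apply, Matrix.mul_apply, Fin.sum_univ_two, val_one_one]
  ring

/-- The `(1, 0)` entry of a bracket in `sl₂(K)`. -/
lemma lie_val_one_zero (x y : sl (Fin 2) K) :
    ⁅x, y⁆.val 1 0 = 2 * (x.val 1 0 * y.val 0 0 - x.val 0 0 * y.val 1 0) := by
  simp only [sl_bracket, Matrix.sub_apply, Matrix.mul_apply, Fin.sum_univ_two, val_one_one]
  ring

/-- The `(0, 0)` entry of a bracket in `sl₂(K)`. -/
lemma lie_val_zero_zero (x y : sl (Fin 2) K) :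
    ⁅x, y⁆.val 0 0 = x.val 0 1 * y.val 1 0 - x.val 1 0 * y.val 0 1 := by
  simp only [sl_bracket, Matrix.sub_apply, Matrix.mul_apply, Fin.sum_univ_two]
  ring

/-- The representation `rho : sl₂(K) → End (ℕ →₀ K)`, `x ↦ x₀₁ E₀ + x₁₀ F₀ + x₀₀ H₀`. -/
def rho (x : sl (Fin 2) K) : Module.End K (ℕ →₀ K) :=
  x.val 0 1 • E₀ K + x.val 1 0 • F₀ K μ + x.val 0 0 • H₀ K μ

/-- `rho` is additive. -/
lemma rho_add (x y : sl (Fin 2) K) : rho K μ (x + y) = rho K μ x + rho K μ y := by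
  simp only [rho, AddMemClass.coe_add, Matrix.add_apply, add_smul]
  abel

/-- `rho` is homogeneous. -/
lemma rho_smul (r : K) (x : sl (Fin 2) K) : rho K μ (r • x) = r • rho K μ x := by
  simp only [rho, SetLike.val_smul, Matrix.smul_apply, smul_eq_mul, mul_smul, smul_add]

/-- `rho` is a Lie algebra homomorphism: `rho ⁅x, y⁆ = rho x ∘ rho y − rho y ∘ rho x`. -/
lemma rho_lie (x y : sl (Fin 2) K) :
    rho K μ ⁅x, y⁆ = rho K μ x * rho K μ y - rho K μ y * rho K μ x := by
  have key := commutator_combination K (A := Module.End K (ℕ →₀ K)) (E₀_F₀_comm K μ)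
    (H₀_E₀_comm K μ) (H₀_F₀_comm K μ)
    (x.val 0 1) (x.val 1 0) (x.val 0 0) (y.val 0 1) (y.val 1 0) (y.val 0 0)
  simp only [rho]
  rw [lie_val_zero_one, lie_val_one_zero, lie_val_zero_zero]
  exact key.symm

/-- `rho x = x₀₁ E₀ + x₁₀ F₀ + x₀₀ H₀`. -/
lemma rho_apply (x : sl (Fin 2) K) :
    rho K μ x = x.val 0 1 • E₀ K + x.val 1 0 • F₀ K μ + x.val 0 0 • H₀ K μ := rfl

/-- `rho e₀ = E₀`. -/
lemma rho_e₀ : rho K μ (e₀ K) = E₀ K := by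
  rw [rho_apply, val_e₀]
  simp

/-- `rho f₀ = F₀`. -/
lemma rho_f₀ : rho K μ (f₀ K) = F₀ K μ := by
  rw [rho_apply, val_f₀]
  simp

/-- `rho h₀ = H₀`. -/
lemma rho_h₀ : rho K μ (h₀ K) = H₀ K μ := by
  rw [rho_apply, val_h₀]
  simp

end Operators

section Model

variable (K : Type*) [Field K]

/-- The model of the lowest-weight module of weight `μ`: the type `ℕ →₀ K` with the action
`rho` (the weight `μ` is a phantom parameter of the type synonym). -/
def Model (_ : K) : Type _ := ℕ →₀ K

variable (μ : K)

/-- The additive group of the model is that of `ℕ →₀ K`. -/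
instance : AddCommGroup (Model K μ) := inferInstanceAs (AddCommGroup (ℕ →₀ K))

/-- The `K`-module structure of the model is that of `ℕ →₀ K`. -/
instance : Module K (Model K μ) := inferInstanceAs (Module K (ℕ →₀ K))

/-- The model is non-trivial. -/
instance : Nontrivial (Model K μ) := inferInstanceAs (Nontrivial (ℕ →₀ K))

/-- The `sl₂(K)`-action on the model: `⁅x, w⁆ = rho x w`. -/
instance : LieRingModule (sl (Fin 2) K) (Model K μ) where
  bracket x w := rho K μ x w
  add_lie x y w := by
    show rho K μ (x + y) w = rho K μ x w + rho K μ y w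
    rw [rho_add, LinearMap.add_apply]
  lie_add x w w' := by
    show rho K μ x (w + w') = rho K μ x w + rho K μ x w'
    exact map_add _ _ _
  leibniz_lie x y w := by
    show rho K μ x (rho K μ y w) = rho K μ ⁅x, y⁆ w + rho K μ y (rho K μ x w)
    rw [rho_lie, LinearMap.sub_apply, Module.End.mul_apply, Module.End.mul_apply, sub_add_cancel]

/-- The action of the model is `K`-bilinear. -/
instance : LieModule K (sl (Fin 2) K) (Model K μ) where
  smul_lie t x w := by
    show rho K μ (t • x) w = t • rho K μ x w
    rw [rho_smul, LinearMap.smul_apply]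
  lie_smul t x w := by
    show rho K μ x (t • w) = t • rho K μ x w
    exact map_smul _ _ _

/-- The basis vector `vₙ = single n 1`. -/
def v (n : ℕ) : Model K μ := Finsupp.single n 1

/-- The underlying finitely supported function of an element of the model. -/
def toFinsupp (w : Model K μ) : ℕ →₀ K := w

/-- The bracket of the model is `rho`. -/
lemma lie_eq (x : sl (Fin 2) K) (w : Model K μ) : ⁅x, w⁆ = rho K μ x w := rfl

/-- `vₙ ≠ 0`. -/
lemma v_ne_zero (n : ℕ) : v K μ n ≠ 0 := Finsupp.single_ne_zero.mpr one_ne_zero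

/-- `c • vₙ = single n c`. -/
lemma smul_v (c : K) (n : ℕ) : c • v K μ n = (show Model K μ from Finsupp.single n c) :=
  Finsupp.smul_single_one n c

/-- `⁅e₀, vₙ⁆ = vₙ₊₁`. -/
lemma lie_e₀_v (n : ℕ) : ⁅e₀ K, v K μ n⁆ = v K μ (n + 1) := by
  rw [lie_eq, rho_e₀]
  exact E₀_single K n 1

/-- `⁅f₀, v₀⁆ = 0`. -/
lemma lie_f₀_v_zero : ⁅f₀ K, v K μ 0⁆ = 0 := by
  rw [lie_eq, rho_f₀]
  exact F₀_single_zero K μ 1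

/-- `⁅f₀, vₙ₊₁⁆ = (n + 1)(−μ − n) • vₙ`. -/
lemma lie_f₀_v_succ (n : ℕ) : ⁅f₀ K, v K μ (n + 1)⁆ = (((n : K) + 1) * (-μ - n)) • v K μ n := by
  rw [lie_eq, rho_f₀, smul_v]
  show F₀ K μ (Finsupp.single (n + 1) 1) = _
  rw [F₀_single_succ, mul_one]

/-- `⁅h₀, vₙ⁆ = (μ + 2n) • vₙ`. -/
lemma lie_h₀_v (n : ℕ) : ⁅h₀ K, v K μ n⁆ = (μ + 2 * n) • v K μ n := by
  rw [lie_eq, rho_h₀, smul_v]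
  show H₀ K μ (Finsupp.single n 1) = _
  rw [H₀_single, mul_one]

/-- `v₀` is a lowest-weight vector of weight `μ` for the standard triple. -/
theorem hasLowestWeightVector : HasLowestWeightVector (isSl2Triple K) (v K μ 0) μ where
  ne_zero := v_ne_zero K μ 0
  lie_h := by simpa using lie_h₀_v K μ 0
  lie_f := lie_f₀_v_zero K μ

end Model

end

end Summit.Ventures.HodgeRepro2.T5Sl2LowestWeightModel
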